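import Literature.MathematicalPhysics.QuantumFieldTheory.Balaban1983to89.B9Cor36CinvCubeLocDefectTransfer
import Literature.MathematicalPhysics.QuantumFieldTheory.Balaban1983to89.B9Cor36CubeSandwichQ
import Literature.MathematicalPhysics.QuantumFieldTheory.Balaban1983to89.B9Thm39CinvSepMiddle

/-!
# `Balaban1983to89.B9Cor36CinvCubeLocDefectCore` — THE CUBE-SIDE LOCALIZED DEFECT CORE `1_S·D_□·1_S` OF p21's (3.95) FOURTH SUM: ITS CONJ-`b` DECOMPOSITION INTO THE
# OUTER-`N` WORD `1_S·(η⁴X̂_□)·(1 − 1_N)·(η⁻⁴C_□)·1_S` AND THE INNER-`(1 − χ²)` WORD `1_S·Q′_□(η²G′_□)(1 − χ²)(η²G′_□)Q′_□*·1_N·(η⁻⁴C_□)·1_S`, AND ITS BLOCK MAJORANT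
# `𝟙_S(a)·(κ_A·e^{−a_sep δ₀ D_N} + κ_B·e^{−a_sep δ₀ D_χ})·e^{−ρδ₀d}` FROM [4] (2.83) WITH THE SEPARATION IN THE MIDDLE — the `hD` binder of FILE E2-3a
# (sub-row G-B9-LETTERS, module M5.2-E, FILE E2-3b-ii; design (β) of `lit-balaban-p21/M52E-DESIGN-p21.md`)

T. Bałaban, *Propagators for lattice gauge theories in a background field*, Commun. Math. Phys. **99** (1985) 389–434
[`Balaban1985BackgroundPropagators`, "B9"]; [4] = T. Bałaban, *Propagators and renormalization transformations for lattice gauge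
theories. II*, Commun. Math. Phys. **96** (1984) 223–250 [`Balaban1984PropagatorsII`].

statement-level skeleton of published theorems with citation tags; proofs where landed; nothing here is a claim about the
Yang–Mills mass gap

THE PRINTED LOCUS (verbatim, held `paper:balaban1985-cmp99-background-propagators`, journal page = PDF page + 388).  (3.95) p. 411; p. 412 l. 31–36 (the C-part *«can be
estimated by O(1)M^{−4}R^{d}_{n+1}exp(−δM)»* — smallness by SEPARATION); [4] (2.82)–(2.85) pp. 237–238 (*«the terms localized far from each other give small contributions»*),
(2.52)–(2.55) p. 232, Lemma 2.1 (2.61) p. 234; Thm 3.1 (3.42) p. 397, Thm 3.2 (3.48) p. 398, p. 409 l. 2–5.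

WHY THIS FILE.  FILE E2-3a (`B9Cor36CinvCubeLocDefectTransfer.hasMajorant_conj_cinvLocDefectY`) reduces M5.6's per-cube `hEd` binder to ONE cube-side datum: a block majorant
`K_C` of `conj b ((1_S ∘ D_□ ∘ 1_S)|_ℝ)`, `D_□ = cinvDefectCoreY i □ parS χ Ṽ N` (FILE E2-1), over a cube geometry.  THIS FILE supplies it over `(toB6 (geoCK i □) Rr Hp, Prod.fst)`:
* §1 ALGEBRA: ★ `cutMulY_ind_QpCubeY_eq` (`1_S·Q′_□ = 1_S·Q′_□·1_Š`, `Š` = the sites of the blocks of `S` — block locality of `Q′_□`); ★★ `conj_locDefectCore_eq` — the conj-`b`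
  decomposition displayed in the title, print's units inserted (`η⁴·η⁻⁴ = 1`, `η²·η²·η⁻⁴ = 1`).
* §2 ESTIMATE: ★★★ `hasMajorant_conj_locDefectCore` — from the SITE-level (3.42)₁ majorant `conj b(η²G′_□(Ṽ)|_ℝ) ≺ B_G·ℓ(a)²·e^{−δ₀d}` (p33's Cor. 3.5 for `G′_□`, hypothesis
  `hG`), the BLOCK-level (3.48) majorant `conj b(η⁻⁴C_□(Ṽ)|_ℝ) ≺ B_C·ℓ(a)^{−4}·e^{−δ₀d}` (FILE E2-4d `cor35_Cinv_cube`, hypothesis `hC`), bi-contractive transporters, the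
  (2.54)∕(2.61) axioms and the scale transfers of `ℓ²`, `ℓ⁻⁴` for the cube geometry (p33 5a), a cut-off `0 ≦ χ ≦ 1` equal to `1` on the blocks outside `Z_χ`, and the two
  separations `D_N ≦ d(S, blocks ∉ N)`, `D_χ ≦ d(S, Z_χ)`: `conj b((1_S·D_□·1_S)|_ℝ) ≺ 𝟙_S(a)·(κ_A·e^{−a_sepδ₀D_N} + κ_B·e^{−a_sepδ₀D_χ})·e^{−ρδ₀d(a,a′)}` with explicit
  `κ_A, κ_B` — three applications of FILE E2-3b-i's `sepMiddle_majorant_blk` (outer word; inner word at the SITE level, then FILE E2-4a's `Q′_□ … Q′_□*` sandwich, then the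
  right factor `1_N·(η⁻⁴C_□)`).

HONEST SCOPE.  Bookkeeping + [4] §2 majorant algebra over DEFINED objects; every analytic input is a displayed hypothesis (suppliers named above).  Count-neutral; no summit ∕
sub-problem statement is proved; nothing continuum ∕ OS ∕ mass-gap ∕ Clay.  No `sorry`, no `axiom`, no `… : Prop` fact, no `instance`, no `notation`, no `def`.  NEW file;
nothing landed is modified.  Cell `lit-balaban`, seat `lit-balaban-p21` gen 34, 2026-08-28; `--supports stmt-QuantumFields-19200` as helper.  Net new unproved facts: 0.

RELATED IN THE TREE, NOT DUPLICATED (searched 2026-08-28): p21 E2-1 `B9Cor36CinvCubeLocLetter` (`cinvDefectCoreY`, `cubeBlkInd`), E2-3a (consumer), E2-3b-i `B9Thm39CinvSepMiddle`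
(engine), E2-4a `B9Cor36CubeSandwichQ` (`hasMajorant_conj_QpCubeY_sandwich_QpsCubeY`, `smul_XCubeY_restrictScalars`), E2-4d (supplier of `hC`); r06 `B9Thm39CinvTorusRegular.conj_cutMulY`,
`B9Thm39Sum.hasMajorant_mulOp_cut`, `B9Thm37Sum.mulOp`; p33 `B9CubeGeometryInputs` — no existing module modified.
-/

noncomputable section

namespace Literature.MathematicalPhysics.QuantumFieldTheory.Balaban1983to89.B9Cor36CinvCubeLocDefectCore

open B6KLevelCensusIndexV1 (KIdx kGeo)
open B6Cover236MultiLevelBlocks (cubes)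
open B6Geom246MultiLevelBoxL0 (blkOf)
open B6RandomWalk (HasMajorant BlockSupp hasMajorant_mono hasMajorant_add Triangle254 Ineq261 c1_nonneg)
open B9Thm34Ext (toB6)
open B9Eq352DivFormLetters (conj)
open B9Thm37Sum (mulOp mulOp_apply)
open B9Thm39CinvTorusRegular (conj_cutMulY conj_add)
open B9Thm39CinvSepMiddle (sepMiddle_majorant_blk)
open B9CubeLettersOpsL0 (cubeFamY GpCubeY)
open B9CubeLettersBondOpsL0 (BlkCubeY QpCubeY QpsCubeY XCubeY XinvCubeY)
open B9Eq360DeltaPrimeACubeY (blkCubeY blkCubeY_apply)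
open B9Cor36CinvCubeLocLetter (cubeBlkInd cubeBlkInd_apply cinvDefectCoreY)
open B9Cor36CubeSandwichQ (QpCubeY_apply_eq_zero_of hasMajorant_conj_QpCubeY_sandwich_QpsCubeY smul_XCubeY_restrictScalars)
open B9CubeGeometryInputs (geoCK geoCK_len_pos)
open B9Cor35GpCubeInputsAtOne (eta_ne_zero)
open B9Thm37CubeCoverCommutators (cutMulY cutMulY_apply)
open Node00 (SiteY CfgY SiteParY toKT)

variable {d ℓ : ℕ} {hd : 1 ≤ d + 1} {hL : Odd (ℓ + 1) ∧ 1 < ℓ + 1} {b₀ b₁ : ℝ}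
variable {𝔸 : Type} [NormedRing 𝔸] [NormedAlgebra ℂ 𝔸] [CompleteSpace 𝔸] {ι : Type} [Fintype ι] (b : Module.Basis ι ℝ 𝔸)
variable (i : KIdx d ℓ hd hL b₀ b₁) (c : ↥(cubes (toKT i).D.toDomains)) (parS : SiteParY 𝔸 i)

/-! ## §1 Algebra: block locality of `Q′_□` and the conj-`b` decomposition of `1_S·D_□·1_S` -/

/-- the pulled-back indicator `1_Š` of the sites lying in the blocks of `S`. [cite: Balaban1985BackgroundPropagators, (3.19) p.393, bookkeeping] -/
theorem siteInd_apply (S : Finset (BlkCubeY i c)) (z : SiteY i) :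
    cubeBlkInd i c S (blkCubeY i c z) = if blkCubeY i c z ∈ S then 1 else 0 := rfl

/-- ★ **BLOCK LOCALITY OF `Q′_□`**: `1_S·Q′_□(V) = 1_S·Q′_□(V)·1_Š` — `(Q′_□λ)(s)` reads `λ` on the block `s` only.
[cite: Balaban1985BackgroundPropagators, (3.19) p.393, (3.8)–(3.10) p.390, p.409 l.2–5] -/
theorem cutMulY_ind_QpCubeY_eq (V : CfgY 𝔸 i) (S : Finset (BlkCubeY i c)) :
    cutMulY (𝔸 := 𝔸) (cubeBlkInd i c S) ∘ₗ QpCubeY i c parS V =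
      cutMulY (𝔸 := 𝔸) (cubeBlkInd i c S) ∘ₗ QpCubeY i c parS V ∘ₗ cutMulY (𝔸 := 𝔸) (fun z => cubeBlkInd i c S (blkCubeY i c z)) := by
  refine LinearMap.ext fun Λ => funext fun s => ?_
  simp only [LinearMap.comp_apply, cutMulY_apply, cubeBlkInd_apply]
  split_ifs with hs
  · congr 1
    rw [← sub_eq_zero, ← Pi.sub_apply, ← map_sub]
    refine QpCubeY_apply_eq_zero_of i c parS V _ s fun z hz => ?_
    have hz' : blkCubeY i c z ∈ S := by rw [blkCubeY_apply, hz]; exact hs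
    rw [Pi.sub_apply, cutMulY_apply, if_pos hz', Complex.ofReal_one, one_smul, sub_self]
  · rw [Complex.ofReal_zero, zero_smul, zero_smul]

/-- ★★ **THE CONJ-`b` DECOMPOSITION OF THE LOCALIZED DEFECT CORE** (lattice units; print's units `η⁴`, `η⁻⁴`, `η²` are inserted by the consumer, §2):
`conj b((1_S·D_□·1_S)|_ℝ) = M_{1_S}·conj b(X̂|_ℝ)·M_{1−1_N}·conj b(C|_ℝ)·M_{1_S} + M_{1_S}·conj b(Q′|_ℝ ∘ (M_{1_Š}·G′|_ℝ·M_{1−χ²}·G′|_ℝ) ∘ Q′*|_ℝ)·M_{1_N}·conj b(C|_ℝ)·M_{1_S}`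
(`M_f = mulOp (f ∘ fst)`, `D_□ = (X̂(1 − 1_N) + Q′G′(1 − χ²)G′Q′*1_N)·C`, `1_Š` inserted by `cutMulY_ind_QpCubeY_eq`).
[cite: Balaban1985BackgroundPropagators, (3.95) p.411, p.412 l.31–36; Balaban1984PropagatorsII, (2.82)–(2.85) pp.237–238, (2.51)–(2.52) p.232] -/
theorem conj_locDefectCore_eq (χ : SiteY i → ℝ) (V : CfgY 𝔸 i) (N S : Finset (BlkCubeY i c)) :
    conj b ((cutMulY (𝔸 := 𝔸) (cubeBlkInd i c S)).restrictScalars ℝ ∘ₗ (cinvDefectCoreY i c parS χ V N).restrictScalars ℝ ∘ₗ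
        (cutMulY (𝔸 := 𝔸) (cubeBlkInd i c S)).restrictScalars ℝ) =
      mulOp (fun p : BlkCubeY i c × ι => cubeBlkInd i c S p.1) *
          (conj b ((XCubeY i c parS V).restrictScalars ℝ) * mulOp (fun p : BlkCubeY i c × ι => 1 - cubeBlkInd i c N p.1) *
            conj b ((XinvCubeY i c parS V).restrictScalars ℝ)) *
          mulOp (fun p : BlkCubeY i c × ι => cubeBlkInd i c S p.1) +
        mulOp (fun p : BlkCubeY i c × ι => cubeBlkInd i c S p.1) *
          (conj b ((QpCubeY i c parS V).restrictScalars ℝ ∘ₗ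
              ((cutMulY (𝔸 := 𝔸) (fun z => cubeBlkInd i c S (blkCubeY i c z))).restrictScalars ℝ * (GpCubeY i c parS V).restrictScalars ℝ *
                (cutMulY (𝔸 := 𝔸) (fun z => 1 - χ z * χ z)).restrictScalars ℝ * (GpCubeY i c parS V).restrictScalars ℝ) ∘ₗ
              (QpsCubeY i c parS V).restrictScalars ℝ) *
            mulOp (fun p : BlkCubeY i c × ι => cubeBlkInd i c N p.1) * conj b ((XinvCubeY i c parS V).restrictScalars ℝ)) *
          mulOp (fun p : BlkCubeY i c × ι => cubeBlkInd i c S p.1) := by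
  -- Step 1: the operator identity over `ℝ` on the `𝔸`-valued block functions
  have hloc : ∀ u : SiteY i → 𝔸, cutMulY (𝔸 := 𝔸) (cubeBlkInd i c S) (QpCubeY i c parS V u) =
      cutMulY (𝔸 := 𝔸) (cubeBlkInd i c S) (QpCubeY i c parS V (cutMulY (𝔸 := 𝔸) (fun z => cubeBlkInd i c S (blkCubeY i c z)) u)) := fun u => by
    have h := LinearMap.congr_fun (cutMulY_ind_QpCubeY_eq i c parS V S) u
    simpa only [LinearMap.comp_apply] using h
  have hop : (cutMulY (𝔸 := 𝔸) (cubeBlkInd i c S)).restrictScalars ℝ ∘ₗ (cinvDefectCoreY i c parS χ V N).restrictScalars ℝ ∘ₗ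
        (cutMulY (𝔸 := 𝔸) (cubeBlkInd i c S)).restrictScalars ℝ =
      (cutMulY (𝔸 := 𝔸) (cubeBlkInd i c S)).restrictScalars ℝ *
          ((XCubeY i c parS V).restrictScalars ℝ * (cutMulY (𝔸 := 𝔸) (fun s => 1 - cubeBlkInd i c N s)).restrictScalars ℝ *
            (XinvCubeY i c parS V).restrictScalars ℝ) *
          (cutMulY (𝔸 := 𝔸) (cubeBlkInd i c S)).restrictScalars ℝ +
        (cutMulY (𝔸 := 𝔸) (cubeBlkInd i c S)).restrictScalars ℝ *
          (((QpCubeY i c parS V).restrictScalars ℝ ∘ₗ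
              ((cutMulY (𝔸 := 𝔸) (fun z => cubeBlkInd i c S (blkCubeY i c z))).restrictScalars ℝ * (GpCubeY i c parS V).restrictScalars ℝ *
                (cutMulY (𝔸 := 𝔸) (fun z => 1 - χ z * χ z)).restrictScalars ℝ * (GpCubeY i c parS V).restrictScalars ℝ) ∘ₗ
              (QpsCubeY i c parS V).restrictScalars ℝ) *
            (cutMulY (𝔸 := 𝔸) (cubeBlkInd i c N)).restrictScalars ℝ * (XinvCubeY i c parS V).restrictScalars ℝ) *
          (cutMulY (𝔸 := 𝔸) (cubeBlkInd i c S)).restrictScalars ℝ := by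
    refine LinearMap.ext fun w => ?_
    simp only [cinvDefectCoreY, LinearMap.comp_apply, LinearMap.add_apply, Module.End.mul_apply, LinearMap.restrictScalars_apply, map_add]
    rw [← hloc]
  rw [hop, conj_add, B9Eq352DivFormLetters.conj_mul, B9Eq352DivFormLetters.conj_mul, B9Eq352DivFormLetters.conj_mul, B9Eq352DivFormLetters.conj_mul,
    B9Eq352DivFormLetters.conj_mul, B9Eq352DivFormLetters.conj_mul, B9Eq352DivFormLetters.conj_mul, B9Eq352DivFormLetters.conj_mul, conj_cutMulY, conj_cutMulY,
    conj_cutMulY]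

/-! ## §2 The block majorant of the localized defect core -/

omit [CompleteSpace 𝔸] in
/-- a right cut-off `|f| ≦ 1` keeps a block majorant. [cite: Balaban1984PropagatorsII, (2.51)–(2.52) p.232, bookkeeping] -/
theorem hasMajorant_mul_mulOp {G : B6.Geometry} {X : Type} (blk : X → G.Site) {T : Module.End ℝ (X → ℝ)} {K : G.Site → G.Site → ℝ}
    (hT : HasMajorant (g := G) blk T K) (f : X → ℝ) (hf : ∀ x, |f x| ≤ 1) : HasMajorant (g := G) blk (T * mulOp f) K := by
  intro y' μ B hμ x
  rw [Module.End.mul_apply]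
  refine hT y' (mulOp f μ) B ⟨hμ.nonneg, fun x' hx' => ?_, fun x' hx' => ?_⟩ x
  · rw [mulOp_apply, abs_mul]
    exact (mul_le_mul (hf x') (hμ.bound x' hx') (abs_nonneg _) zero_le_one).trans_eq (one_mul _)
  · rw [mulOp_apply, hμ.off x' hx', mul_zero]

omit [NormedRing 𝔸] [NormedAlgebra ℂ 𝔸] [CompleteSpace 𝔸] [Fintype ι] in
/-- `mulOp 1 = 1`. [cite: Balaban1984PropagatorsII, (2.52) p.232, bookkeeping] -/
theorem mulOp_const_one {X : Type} : mulOp (fun _ : X => (1 : ℝ)) = 1 := by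
  refine LinearMap.ext fun μ => funext fun x => ?_
  rw [mulOp_apply, one_mul, Module.End.one_apply]

omit [NormedRing 𝔸] [NormedAlgebra ℂ 𝔸] [CompleteSpace 𝔸] [Fintype ι] in
/-- `ℓ(a)²·ℓ(a)²·ℓ(a)^{−4} = 1` on the cube geometry. [cite: Balaban1985BackgroundPropagators, (3.48) p.398, bookkeeping] -/
theorem len_sq_sq_rpow_neg4 (a : BlkCubeY i c) : (geoCK i c).len a ^ 2 * (geoCK i c).len a ^ 2 * (geoCK i c).len a ^ (-(4 : ℝ)) = 1 := by
  have h := geoCK_len_pos i c a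
  rw [Real.rpow_neg h.le, show ((4 : ℝ)) = ((4 : ℕ) : ℝ) by norm_num, Real.rpow_natCast, ← pow_add, show 2 + 2 = 4 from rfl, mul_inv_cancel₀ (pow_ne_zero 4 h.ne')]

/-- ★★★ **THE BLOCK MAJORANT OF THE LOCALIZED DEFECT CORE `1_S·D_□·1_S`** over `(toB6 (geoCK i □) Rr Hp, Prod.fst)` — the `hD` binder of FILE E2-3a: from the site-level
(3.42)₁ majorant of `conj b(η²G′_□(Ṽ))` (`hG`), the block-level (3.48) majorant of `conj b(η⁻⁴C_□(Ṽ))` (`hC`), bi-contractive transporters (`hpar`), (2.54), (2.61) at the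
exponents `1/10, 3/5, 3/4`, the scale transfers of `ℓ²` and `ℓ^{−4}` at `1/10`, a cut-off `0 ≦ χ ≦ 1` equal to `1` on the blocks outside `Z_χ`, and the separations
`D_N ≦ d(S, ∁N)`, `D_χ ≦ d(S, Z_χ)`:
  `conj b((1_S·D_□·1_S)|_ℝ) ≺ 𝟙_S(a)·(κ_A·e^{−(2/5)δ₀D_N} + κ_B·e^{−(2/5)δ₀D_χ})·e^{−(1/4)δ₀d(a,a′)}`,
`κ_A = (M₂Σ‖b‖)²B_G²Λc₁(1/10)·B_CΛc₁(3/5)`, `κ_B = (M₂Σ‖b‖)²B_G²Λc₁(3/5)·B_CΛc₁(3/4)` — three uses of [4] (2.83) with the separation in the middle (FILE E2-3b-i), FILE E2-4a's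
`Q′_□ … Q′_□*` sandwich, and §1. [cite: Balaban1985BackgroundPropagators, (3.95) p.411, p.412 l.31–36, Thm 3.1 (3.42) p.397, Thm 3.2 (3.48) p.398; Balaban1984PropagatorsII, (2.82)–(2.85) pp.237–238, Lemma 2.1 (2.61) p.234, (2.51)–(2.55) p.232] -/
theorem hasMajorant_conj_locDefectCore {M₂ : ℝ} (hM₂ : 0 ≤ M₂) (hrepr : ∀ (v : 𝔸) (j : ι), |b.repr v j| ≤ M₂ * ‖v‖) (V : CfgY 𝔸 i)
    (hpar : ∀ z w : SiteY i, ‖(parS V z w : 𝔸)‖ ≤ 1 ∧ ‖(((parS V z w)⁻¹ : 𝔸ˣ) : 𝔸)‖ ≤ 1)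
    {Rr : ℝ} {Hp : Prop} (hdnn : ∀ a a' : BlkCubeY i c, 0 ≤ (geoCK i c).dist a a') (htri : Triangle254 (toB6 (geoCK i c) Rr Hp))
    (hsymm : ∀ a a' : BlkCubeY i c, (geoCK i c).dist a a' = (geoCK i c).dist a' a)
    (dB : ℕ) {δ₀ Λ BG BC : ℝ} (hδ₀ : 0 ≤ δ₀) (hΛ : 0 ≤ Λ) (hBG : 0 ≤ BG) (hBC : 0 ≤ BC)
    (h261a : Ineq261 dB (toB6 (geoCK i c) Rr Hp) δ₀ (1 - 9 / 10)) (h261b : Ineq261 dB (toB6 (geoCK i c) Rr Hp) δ₀ (1 - 2 / 5))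
    (h261c : Ineq261 dB (toB6 (geoCK i c) Rr Hp) δ₀ (1 - 1 / 4))
    (hST2 : B9Ineq347.ScaleTransfer (geoCK i c) δ₀ (1 / 10) Λ (fun a => (geoCK i c).len a ^ 2))
    (hST4 : B9Ineq347.ScaleTransfer (geoCK i c) δ₀ (1 / 10) Λ (fun a => (geoCK i c).len a ^ (-(4 : ℝ))))
    (χ : SiteY i → ℝ) (hχ0 : ∀ z, 0 ≤ χ z) (hχ1 : ∀ z, χ z ≤ 1) (Zχ : Finset (BlkCubeY i c)) (hχZ : ∀ z, blkCubeY i c z ∉ Zχ → χ z = 1)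
    (N S : Finset (BlkCubeY i c)) {DN Dχ : ℝ} (hDN : ∀ a ∈ S, ∀ y, y ∉ N → DN ≤ (geoCK i c).dist a y) (hDχ : ∀ a ∈ S, ∀ y ∈ Zχ, Dχ ≤ (geoCK i c).dist a y)
    (hG : HasMajorant (g := toB6 (geoCK i c) Rr Hp) (fun p : SiteY i × ι => blkCubeY i c p.1)
      (conj b (((kGeo i).eta ^ 2) • (GpCubeY i c parS V).restrictScalars ℝ))
      (fun a a' => BG * (geoCK i c).len a ^ 2 * Real.exp (-(δ₀ * (geoCK i c).dist a a'))))
    (hC : HasMajorant (g := toB6 (geoCK i c) Rr Hp) (fun q : BlkCubeY i c × ι => q.1)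
      (conj b ((((kGeo i).eta ^ 4)⁻¹) • (XinvCubeY i c parS V).restrictScalars ℝ))
      (fun a a' => BC * (geoCK i c).len a ^ (-(4 : ℝ)) * Real.exp (-(δ₀ * (geoCK i c).dist a a')))) :
    HasMajorant (g := toB6 (geoCK i c) Rr Hp) (fun q : BlkCubeY i c × ι => q.1)
      (conj b ((cutMulY (𝔸 := 𝔸) (cubeBlkInd i c S)).restrictScalars ℝ ∘ₗ (cinvDefectCoreY i c parS χ V N).restrictScalars ℝ ∘ₗ
        (cutMulY (𝔸 := 𝔸) (cubeBlkInd i c S)).restrictScalars ℝ))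
      (fun a a' : (geoCK i c).Site => (if a ∈ S then (1 : ℝ) else 0) *
        ((M₂ * ∑ j, ‖b j‖) ^ 2 * (BG * BG * Λ * B6.c1 dB δ₀ (1 - 9 / 10)) * (BC * Λ * B6.c1 dB δ₀ (1 - 2 / 5)) * Real.exp (-(2 / 5 * δ₀ * DN)) +
          (M₂ * ∑ j, ‖b j‖) ^ 2 * (BG * BG * Λ * B6.c1 dB δ₀ (1 - 2 / 5)) * (BC * Λ * B6.c1 dB δ₀ (1 - 1 / 4)) * Real.exp (-(2 / 5 * δ₀ * Dχ))) *
        Real.exp (-(1 / 4 * δ₀ * (geoCK i c).dist a a'))) := by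
  have hη4 : ((kGeo i).eta ^ 4 : ℝ) ≠ 0 := pow_ne_zero 4 (eta_ne_zero i)
  have hc1a : 0 ≤ B6.c1 dB δ₀ (1 - 9 / 10) := c1_nonneg _ _ _
  have hc1b : 0 ≤ B6.c1 dB δ₀ (1 - 2 / 5) := c1_nonneg _ _ _
  have hκX : 0 ≤ (M₂ * ∑ j, ‖b j‖) ^ 2 * (BG * BG * Λ * B6.c1 dB δ₀ (1 - 9 / 10)) :=
    mul_nonneg (sq_nonneg _) (mul_nonneg (mul_nonneg (mul_nonneg hBG hBG) hΛ) hc1a)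
  have hℓ2 : ∀ a : BlkCubeY i c, 0 ≤ (geoCK i c).len a ^ 2 := fun a => sq_nonneg _
  have hℓ4 : ∀ a : BlkCubeY i c, 0 ≤ (geoCK i c).len a ^ (-(4 : ℝ)) := fun a => Real.rpow_nonneg (geoCK_len_pos i c a).le _
  have hind1 : ∀ (T : Finset (BlkCubeY i c)) (s : BlkCubeY i c), |cubeBlkInd i c T s| ≤ 1 := fun T s => by
    rw [cubeBlkInd_apply]; split_ifs <;> norm_num
  have hind1' : ∀ (T : Finset (BlkCubeY i c)) (s : BlkCubeY i c), |1 - cubeBlkInd i c T s| ≤ 1 := fun T s => by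
    rw [cubeBlkInd_apply]; split_ifs <;> norm_num
  -- the two inputs in the `a_L = b = 1` shape of FILE E2-3b-i
  have hG1 : HasMajorant (g := toB6 (geoCK i c) Rr Hp) (fun p : SiteY i × ι => blkCubeY i c p.1)
      (conj b (((kGeo i).eta ^ 2) • (GpCubeY i c parS V).restrictScalars ℝ))
      (fun a a' => BG * (geoCK i c).len a ^ 2 * Real.exp (-(1 * δ₀ * (geoCK i c).dist a a'))) :=
    hasMajorant_mono (g := toB6 (geoCK i c) Rr Hp) _ hG fun a a' => by rw [one_mul]
  have hC1 : HasMajorant (g := toB6 (geoCK i c) Rr Hp) (fun q : BlkCubeY i c × ι => q.1)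
      (conj b ((((kGeo i).eta ^ 4)⁻¹) • (XinvCubeY i c parS V).restrictScalars ℝ))
      (fun a a' => BC * (geoCK i c).len a ^ (-(4 : ℝ)) * Real.exp (-(1 * δ₀ * (geoCK i c).dist a a'))) :=
    hasMajorant_mono (g := toB6 (geoCK i c) Rr Hp) _ hC fun a a' => by rw [one_mul]
  -- STAGE G: `conj b(η²G′)·conj b(η²G′) ≺ B_G²Λc₁(1/10)·ℓ⁴·e^{−(9/10)δ₀d}` at the site level ((2.83) with trivial cut-offs)
  have hGG₀ := sepMiddle_majorant_blk (R := Rr) (H := Hp) (fun p : SiteY i × ι => blkCubeY i c p.1) dB δ₀ 1 (1 / 10) 0 (9 / 10) 1 BG BG Λ 0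
    (fun a => (geoCK i c).len a ^ 2) (fun a => (geoCK i c).len a ^ 2) (fun a => (geoCK i c).len a ^ 2) Finset.univ Finset.univ
    (fun _ => (1 : ℝ)) (fun _ => (1 : ℝ)) hBG hBG hΛ hℓ2 hℓ2 hℓ2 hδ₀ le_rfl (by norm_num) (by norm_num) htri hsymm hdnn hST2 h261a
    (fun _ => by norm_num) (fun _ h => absurd (Finset.mem_univ _) h) (fun _ => by norm_num) (fun _ h => absurd (Finset.mem_univ _) h)
    (fun a _ y _ => hdnn a y) hG1 hG1
  rw [mulOp_const_one, one_mul, mul_one, ← B9Eq352DivFormLetters.conj_mul, smul_mul_smul_comm, ← pow_add, show 2 + 2 = 4 from rfl] at hGG₀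
  have hGG : HasMajorant (g := toB6 (geoCK i c) Rr Hp) (fun p : SiteY i × ι => blkCubeY i c p.1)
      (conj b (((kGeo i).eta ^ 4) • ((GpCubeY i c parS V).restrictScalars ℝ * (GpCubeY i c parS V).restrictScalars ℝ)))
      (fun a a' => (BG * BG * Λ * B6.c1 dB δ₀ (1 - 9 / 10)) * ((geoCK i c).len a ^ 2 * (geoCK i c).len a ^ 2) *
        Real.exp (-(9 / 10 * δ₀ * (geoCK i c).dist a a'))) :=
    hasMajorant_mono (g := toB6 (geoCK i c) Rr Hp) _ hGG₀ fun a a' => le_of_eq (by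
      simp only [Finset.mem_univ, if_true, one_mul, mul_zero, neg_zero, Real.exp_zero, mul_one])
  -- `conj b(η⁴X̂) ≺ (M₂Σ‖b‖)²·(…)·ℓ⁴·e^{−(9/10)δ₀d}` at the block level (FILE E2-4a)
  have hX := B9Cor36CubeSandwichQ.hasMajorant_conj_XCubeY_of_site i c b parS V (Rr := Rr) (Hp := Hp) hpar hM₂ hrepr ((kGeo i).eta ^ 4)
    (fun a a' => mul_nonneg (mul_nonneg (mul_nonneg (mul_nonneg (mul_nonneg hBG hBG) hΛ) hc1a) (mul_nonneg (hℓ2 a) (hℓ2 a))) (Real.exp_nonneg _)) hGG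
  have hX' : HasMajorant (g := toB6 (geoCK i c) Rr Hp) (fun q : BlkCubeY i c × ι => q.1)
      (conj b (((kGeo i).eta ^ 4) • (XCubeY i c parS V).restrictScalars ℝ))
      (fun a a' => ((M₂ * ∑ j, ‖b j‖) ^ 2 * (BG * BG * Λ * B6.c1 dB δ₀ (1 - 9 / 10))) * ((geoCK i c).len a ^ 2 * (geoCK i c).len a ^ 2) *
        Real.exp (-(9 / 10 * δ₀ * (geoCK i c).dist a a'))) :=
    hasMajorant_mono (g := toB6 (geoCK i c) Rr Hp) _ hX fun a a' => le_of_eq (by ring)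
  -- STAGE A: the outer word `1_S·conj b(η⁴X̂)·(1 − 1_N)·conj b(η⁻⁴C)`, separation `D_N`
  have hA := sepMiddle_majorant_blk (R := Rr) (H := Hp) (fun q : BlkCubeY i c × ι => q.1) dB δ₀ (9 / 10) (1 / 10) (2 / 5) (2 / 5) 1
    ((M₂ * ∑ j, ‖b j‖) ^ 2 * (BG * BG * Λ * B6.c1 dB δ₀ (1 - 9 / 10))) BC Λ DN
    (fun a => (geoCK i c).len a ^ 2 * (geoCK i c).len a ^ 2) (fun a => (geoCK i c).len a ^ (-(4 : ℝ))) (fun a => (geoCK i c).len a ^ (-(4 : ℝ)))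
    S (Finset.univ \ N) (fun q => cubeBlkInd i c S q.1) (fun q => 1 - cubeBlkInd i c N q.1)
    hκX hBC hΛ (fun a => mul_nonneg (hℓ2 a) (hℓ2 a)) hℓ4 hℓ4 hδ₀ (by norm_num) (by norm_num) (by norm_num) htri hsymm hdnn hST4 h261b
    (fun q => hind1 S q.1) (fun q hq => by rw [cubeBlkInd_apply, if_neg hq]) (fun q => hind1' N q.1)
    (fun q hq => by
      have hN : q.1 ∈ N := by by_contra h; exact hq (Finset.mem_sdiff.2 ⟨Finset.mem_univ _, h⟩)
      rw [cubeBlkInd_apply, if_pos hN, sub_self])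
    (fun a ha y hy => hDN a ha y (Finset.mem_sdiff.1 hy).2) hX' hC1
  have hA' := hasMajorant_mul_mulOp (G := toB6 (geoCK i c) Rr Hp) (fun q : BlkCubeY i c × ι => q.1) hA (fun q => cubeBlkInd i c S q.1)
    fun q => hind1 S q.1
  -- STAGE B1: the inner word `1_Š·conj b(η²G′)·(1 − χ²)·conj b(η²G′)` at the site level, separation `D_χ`
  have hB1 := sepMiddle_majorant_blk (R := Rr) (H := Hp) (fun p : SiteY i × ι => blkCubeY i c p.1) dB δ₀ 1 (1 / 10) (2 / 5) (2 / 5) 1 BG BG Λ Dχ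
    (fun a => (geoCK i c).len a ^ 2) (fun a => (geoCK i c).len a ^ 2) (fun a => (geoCK i c).len a ^ 2) S Zχ
    (fun p => cubeBlkInd i c S (blkCubeY i c p.1)) (fun p => 1 - χ p.1 * χ p.1)
    hBG hBG hΛ hℓ2 hℓ2 hℓ2 hδ₀ (by norm_num) (by norm_num) (by norm_num) htri hsymm hdnn hST2 h261b
    (fun p => hind1 S _) (fun p hp => by rw [cubeBlkInd_apply, if_neg hp])
    (fun p => by
      have h0 := hχ0 p.1; have h1 := hχ1 p.1
      rw [abs_le]; constructor <;> nlinarith [mul_nonneg h0 h0])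
    (fun p hp => by rw [hχZ p.1 hp, mul_one, sub_self]) hDχ hG1 hG1
  rw [← conj_cutMulY b (fun z : SiteY i => cubeBlkInd i c S (blkCubeY i c z)), ← conj_cutMulY b (fun z : SiteY i => 1 - χ z * χ z),
    ← B9Eq352DivFormLetters.conj_mul, ← B9Eq352DivFormLetters.conj_mul, ← B9Eq352DivFormLetters.conj_mul] at hB1
  -- STAGE B2: the `Q′_□ … Q′_□*` sandwich (FILE E2-4a)
  have hB2 := hasMajorant_conj_QpCubeY_sandwich_QpsCubeY i c b parS V (Rr := Rr) (Hp := Hp) hpar hM₂ hrepr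
    (fun a a' => mul_nonneg (mul_nonneg (mul_nonneg (by split_ifs <;> norm_num)
      (mul_nonneg (mul_nonneg (mul_nonneg (mul_nonneg hBG hBG) hΛ) hc1b) (Real.exp_nonneg _))) (mul_nonneg (hℓ2 a) (hℓ2 a))) (Real.exp_nonneg _)) hB1
  have hB2' : HasMajorant (g := toB6 (geoCK i c) Rr Hp) (fun q : BlkCubeY i c × ι => q.1)
      (conj b ((QpCubeY i c parS V).restrictScalars ℝ ∘ₗ
        ((cutMulY (𝔸 := 𝔸) (fun z => cubeBlkInd i c S (blkCubeY i c z))).restrictScalars ℝ *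
          (((kGeo i).eta ^ 2) • (GpCubeY i c parS V).restrictScalars ℝ) * (cutMulY (𝔸 := 𝔸) (fun z => 1 - χ z * χ z)).restrictScalars ℝ *
          (((kGeo i).eta ^ 2) • (GpCubeY i c parS V).restrictScalars ℝ)) ∘ₗ (QpsCubeY i c parS V).restrictScalars ℝ))
      (fun a a' : (geoCK i c).Site => (M₂ * ∑ j, ‖b j‖) ^ 2 *
        ((if a ∈ S then (1 : ℝ) else 0) * (BG * BG * Λ * B6.c1 dB δ₀ (1 - 2 / 5) * Real.exp (-(2 / 5 * δ₀ * Dχ))) *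
          ((geoCK i c).len a ^ 2 * (geoCK i c).len a ^ 2)) * Real.exp (-(2 / 5 * δ₀ * (geoCK i c).dist a a'))) :=
    hasMajorant_mono (g := toB6 (geoCK i c) Rr Hp) _ hB2 fun a a' => le_of_eq (by simp only [mul_assoc])
  -- STAGE B3: `1_S·(…)·1_N·conj b(η⁻⁴C)` ((2.83) with no separation)
  have hB3 := sepMiddle_majorant_blk (R := Rr) (H := Hp) (fun q : BlkCubeY i c × ι => q.1) dB δ₀ (2 / 5) (1 / 10) 0 (1 / 4) 1
    ((M₂ * ∑ j, ‖b j‖) ^ 2) BC Λ 0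
    (fun a : (geoCK i c).Site => (if a ∈ S then (1 : ℝ) else 0) * (BG * BG * Λ * B6.c1 dB δ₀ (1 - 2 / 5) * Real.exp (-(2 / 5 * δ₀ * Dχ))) *
      ((geoCK i c).len a ^ 2 * (geoCK i c).len a ^ 2))
    (fun a => (geoCK i c).len a ^ (-(4 : ℝ))) (fun a => (geoCK i c).len a ^ (-(4 : ℝ))) S Finset.univ (fun q => cubeBlkInd i c S q.1) (fun q => cubeBlkInd i c N q.1)
    (sq_nonneg _) hBC hΛ
    (fun a => mul_nonneg (mul_nonneg (by split_ifs <;> norm_num) (mul_nonneg (mul_nonneg (mul_nonneg (mul_nonneg hBG hBG) hΛ) hc1b) (Real.exp_nonneg _)))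
      (mul_nonneg (hℓ2 a) (hℓ2 a)))
    hℓ4 hℓ4 hδ₀ le_rfl (by norm_num) (by norm_num) htri hsymm hdnn hST4 h261c
    (fun q => hind1 S q.1) (fun q hq => by rw [cubeBlkInd_apply, if_neg hq]) (fun q => hind1 N q.1) (fun _ h => absurd (Finset.mem_univ _) h)
    (fun a _ y _ => hdnn a y) hB2' hC1
  have hB3' := hasMajorant_mul_mulOp (G := toB6 (geoCK i c) Rr Hp) (fun q : BlkCubeY i c × ι => q.1) hB3 (fun q => cubeBlkInd i c S q.1)
    fun q => hind1 S q.1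
  -- the scalar bookkeeping `η⁴·η⁻⁴ = 1`, `η²·η²·η⁻⁴ = 1` matching §1's lattice-unit decomposition
  have hAeq : conj b ((XCubeY i c parS V).restrictScalars ℝ) * mulOp (fun p : BlkCubeY i c × ι => 1 - cubeBlkInd i c N p.1) *
        conj b ((XinvCubeY i c parS V).restrictScalars ℝ) =
      conj b (((kGeo i).eta ^ 4) • (XCubeY i c parS V).restrictScalars ℝ) * mulOp (fun p : BlkCubeY i c × ι => 1 - cubeBlkInd i c N p.1) *
        conj b ((((kGeo i).eta ^ 4)⁻¹) • (XinvCubeY i c parS V).restrictScalars ℝ) := by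
    rw [← conj_cutMulY b (fun s : BlkCubeY i c => 1 - cubeBlkInd i c N s), ← B9Eq352DivFormLetters.conj_mul, ← B9Eq352DivFormLetters.conj_mul,
      ← B9Eq352DivFormLetters.conj_mul, ← B9Eq352DivFormLetters.conj_mul, smul_mul_assoc, smul_mul_assoc, mul_smul_comm, smul_smul, mul_inv_cancel₀ hη4,
      one_smul]
  have hWeq : (cutMulY (𝔸 := 𝔸) (fun z => cubeBlkInd i c S (blkCubeY i c z))).restrictScalars ℝ *
        (((kGeo i).eta ^ 2) • (GpCubeY i c parS V).restrictScalars ℝ) * (cutMulY (𝔸 := 𝔸) (fun z => 1 - χ z * χ z)).restrictScalars ℝ *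
        (((kGeo i).eta ^ 2) • (GpCubeY i c parS V).restrictScalars ℝ) =
      ((kGeo i).eta ^ 4) • ((cutMulY (𝔸 := 𝔸) (fun z => cubeBlkInd i c S (blkCubeY i c z))).restrictScalars ℝ * (GpCubeY i c parS V).restrictScalars ℝ *
        (cutMulY (𝔸 := 𝔸) (fun z => 1 - χ z * χ z)).restrictScalars ℝ * (GpCubeY i c parS V).restrictScalars ℝ) := by
    simp only [mul_smul_comm, smul_mul_assoc, smul_smul]
    congr 1
    ring
  have hBeq : conj b ((QpCubeY i c parS V).restrictScalars ℝ ∘ₗ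
          ((cutMulY (𝔸 := 𝔸) (fun z => cubeBlkInd i c S (blkCubeY i c z))).restrictScalars ℝ * (GpCubeY i c parS V).restrictScalars ℝ *
            (cutMulY (𝔸 := 𝔸) (fun z => 1 - χ z * χ z)).restrictScalars ℝ * (GpCubeY i c parS V).restrictScalars ℝ) ∘ₗ
          (QpsCubeY i c parS V).restrictScalars ℝ) *
        mulOp (fun p : BlkCubeY i c × ι => cubeBlkInd i c N p.1) * conj b ((XinvCubeY i c parS V).restrictScalars ℝ) =
      conj b ((QpCubeY i c parS V).restrictScalars ℝ ∘ₗ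
          ((cutMulY (𝔸 := 𝔸) (fun z => cubeBlkInd i c S (blkCubeY i c z))).restrictScalars ℝ *
            (((kGeo i).eta ^ 2) • (GpCubeY i c parS V).restrictScalars ℝ) * (cutMulY (𝔸 := 𝔸) (fun z => 1 - χ z * χ z)).restrictScalars ℝ *
            (((kGeo i).eta ^ 2) • (GpCubeY i c parS V).restrictScalars ℝ)) ∘ₗ (QpsCubeY i c parS V).restrictScalars ℝ) *
        mulOp (fun p : BlkCubeY i c × ι => cubeBlkInd i c N p.1) * conj b ((((kGeo i).eta ^ 4)⁻¹) • (XinvCubeY i c parS V).restrictScalars ℝ) := by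
    rw [hWeq, LinearMap.smul_comp, LinearMap.comp_smul, ← conj_cutMulY b (fun s : BlkCubeY i c => cubeBlkInd i c N s), ← B9Eq352DivFormLetters.conj_mul,
      ← B9Eq352DivFormLetters.conj_mul,
      ← B9Eq352DivFormLetters.conj_mul, ← B9Eq352DivFormLetters.conj_mul, smul_mul_assoc, smul_mul_assoc, mul_smul_comm, smul_smul,
      mul_inv_cancel₀ hη4, one_smul]
  -- assembly
  rw [conj_locDefectCore_eq, hAeq, hBeq,
    show mulOp (fun p : BlkCubeY i c × ι => cubeBlkInd i c S p.1) *
          (conj b (((kGeo i).eta ^ 4) • (XCubeY i c parS V).restrictScalars ℝ) * mulOp (fun p : BlkCubeY i c × ι => 1 - cubeBlkInd i c N p.1) *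
            conj b ((((kGeo i).eta ^ 4)⁻¹) • (XinvCubeY i c parS V).restrictScalars ℝ)) *
          mulOp (fun p : BlkCubeY i c × ι => cubeBlkInd i c S p.1) =
        mulOp (fun p : BlkCubeY i c × ι => cubeBlkInd i c S p.1) * conj b (((kGeo i).eta ^ 4) • (XCubeY i c parS V).restrictScalars ℝ) *
          mulOp (fun p : BlkCubeY i c × ι => 1 - cubeBlkInd i c N p.1) * conj b ((((kGeo i).eta ^ 4)⁻¹) • (XinvCubeY i c parS V).restrictScalars ℝ) *
          mulOp (fun p : BlkCubeY i c × ι => cubeBlkInd i c S p.1) by simp only [mul_assoc]]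
  rw [show ∀ (Y C : Module.End ℝ (BlkCubeY i c × ι → ℝ)),
      mulOp (fun p : BlkCubeY i c × ι => cubeBlkInd i c S p.1) * (Y * mulOp (fun p : BlkCubeY i c × ι => cubeBlkInd i c N p.1) * C) *
          mulOp (fun p : BlkCubeY i c × ι => cubeBlkInd i c S p.1) =
        mulOp (fun p : BlkCubeY i c × ι => cubeBlkInd i c S p.1) * Y * mulOp (fun p : BlkCubeY i c × ι => cubeBlkInd i c N p.1) * C *
          mulOp (fun p : BlkCubeY i c × ι => cubeBlkInd i c S p.1) from fun Y C => by simp only [mul_assoc]]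
  refine hasMajorant_mono (g := toB6 (geoCK i c) Rr Hp) _ (hasMajorant_add (g := toB6 (geoCK i c) Rr Hp) _ hA' hB3') fun a a' => ?_
  -- the final comparison of kernels
  have hℓ := len_sq_sq_rpow_neg4 i c a
  have hexp : Real.exp (-(2 / 5 * δ₀ * (geoCK i c).dist a a')) ≤ Real.exp (-(1 / 4 * δ₀ * (geoCK i c).dist a a')) :=
    Real.exp_le_exp.2 (by nlinarith [hdnn a a'])
  have hcA : 0 ≤ (M₂ * ∑ j, ‖b j‖) ^ 2 * (BG * BG * Λ * B6.c1 dB δ₀ (1 - 9 / 10)) * (BC * Λ * B6.c1 dB δ₀ (1 - 2 / 5)) * Real.exp (-(2 / 5 * δ₀ * DN)) :=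
    mul_nonneg (mul_nonneg hκX (mul_nonneg (mul_nonneg hBC hΛ) hc1b)) (Real.exp_nonneg _)
  split_ifs with ha
  · simp only [one_mul, mul_one, mul_zero, zero_mul, neg_zero, Real.exp_zero]
    calc ((M₂ * ∑ j, ‖b j‖) ^ 2 * (BG * BG * Λ * B6.c1 dB δ₀ (1 - 9 / 10)) * BC * Λ * B6.c1 dB δ₀ (1 - 2 / 5) * Real.exp (-(2 / 5 * δ₀ * DN))) *
            ((geoCK i c).len a ^ 2 * (geoCK i c).len a ^ 2 * (geoCK i c).len a ^ (-(4 : ℝ))) * Real.exp (-(2 / 5 * δ₀ * (geoCK i c).dist a a')) +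
          ((M₂ * ∑ j, ‖b j‖) ^ 2 * BC * Λ * B6.c1 dB δ₀ (1 - 1 / 4)) *
            ((BG * BG * Λ * B6.c1 dB δ₀ (1 - 2 / 5) * Real.exp (-(2 / 5 * δ₀ * Dχ))) * ((geoCK i c).len a ^ 2 * (geoCK i c).len a ^ 2) *
              (geoCK i c).len a ^ (-(4 : ℝ))) * Real.exp (-(1 / 4 * δ₀ * (geoCK i c).dist a a'))
        = ((M₂ * ∑ j, ‖b j‖) ^ 2 * (BG * BG * Λ * B6.c1 dB δ₀ (1 - 9 / 10)) * (BC * Λ * B6.c1 dB δ₀ (1 - 2 / 5)) * Real.exp (-(2 / 5 * δ₀ * DN))) *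
              Real.exp (-(2 / 5 * δ₀ * (geoCK i c).dist a a')) * ((geoCK i c).len a ^ 2 * (geoCK i c).len a ^ 2 * (geoCK i c).len a ^ (-(4 : ℝ))) +
            ((M₂ * ∑ j, ‖b j‖) ^ 2 * (BG * BG * Λ * B6.c1 dB δ₀ (1 - 2 / 5)) * (BC * Λ * B6.c1 dB δ₀ (1 - 1 / 4)) * Real.exp (-(2 / 5 * δ₀ * Dχ))) *
              Real.exp (-(1 / 4 * δ₀ * (geoCK i c).dist a a')) * ((geoCK i c).len a ^ 2 * (geoCK i c).len a ^ 2 * (geoCK i c).len a ^ (-(4 : ℝ))) := by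
          ring
      _ = ((M₂ * ∑ j, ‖b j‖) ^ 2 * (BG * BG * Λ * B6.c1 dB δ₀ (1 - 9 / 10)) * (BC * Λ * B6.c1 dB δ₀ (1 - 2 / 5)) * Real.exp (-(2 / 5 * δ₀ * DN))) *
              Real.exp (-(2 / 5 * δ₀ * (geoCK i c).dist a a')) +
            ((M₂ * ∑ j, ‖b j‖) ^ 2 * (BG * BG * Λ * B6.c1 dB δ₀ (1 - 2 / 5)) * (BC * Λ * B6.c1 dB δ₀ (1 - 1 / 4)) * Real.exp (-(2 / 5 * δ₀ * Dχ))) *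
              Real.exp (-(1 / 4 * δ₀ * (geoCK i c).dist a a')) := by rw [hℓ, mul_one, mul_one]
      _ ≤ ((M₂ * ∑ j, ‖b j‖) ^ 2 * (BG * BG * Λ * B6.c1 dB δ₀ (1 - 9 / 10)) * (BC * Λ * B6.c1 dB δ₀ (1 - 2 / 5)) * Real.exp (-(2 / 5 * δ₀ * DN))) *
              Real.exp (-(1 / 4 * δ₀ * (geoCK i c).dist a a')) +
            ((M₂ * ∑ j, ‖b j‖) ^ 2 * (BG * BG * Λ * B6.c1 dB δ₀ (1 - 2 / 5)) * (BC * Λ * B6.c1 dB δ₀ (1 - 1 / 4)) * Real.exp (-(2 / 5 * δ₀ * Dχ))) *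
              Real.exp (-(1 / 4 * δ₀ * (geoCK i c).dist a a')) := by
          gcongr
      _ = _ := by ring
  · simp only [zero_mul, mul_zero, zero_add, le_refl]

end Literature.MathematicalPhysics.QuantumFieldTheory.Balaban1983to89.B9Cor36CinvCubeLocDefectCore

end
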